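import Summits.BirchSwinnertonDyer.BirchSwinnertonDyer.Theorems.ByReductionTypeAtTwoTorsionEulerCharTowerTorsionNorms
import Literature.NumberTheory.GaloisRepresentations.ContinuousCorestrictionLevelBookkeeping
import Literature.NumberTheory.EllipticCurves.PeriodIndexCorestrictionLocal
import HarnessLib

set_option linter.dupNamespace false -- `…BirchSwinnertonDyer.BirchSwinnertonDyer…` is the cell's nested layout (D-0017)
set_option autoImplicit false

/-!
# H46 kernel programme (road C′), brick B6 — principal classes, `B`-valued classes and their norms down a `ℤ_p`-tower

Cell `bsd-2adic` (run/shared/lean/pub/bsd-2adic/), seat `bsd-2adic-tower-1` GEN 38; `--supports stmt-BirchSwinnertonDyer-19271`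
(helper, item `OrdKatoHalfAtTwo`, TOWER road). THEOREMS ONLY (no definition, no named fact, no instance, no `sorry`); closes no
item; nothing booked; BSD is not proved by any of this.

The bookkeeping lemmas of the finite-coefficient schedule of brick B6 (universal norms of the ♭-Selmer tower WITHOUT the side
condition (T₁); `HOME/tower/gen38/NOTE-B6-SCHEDULE-GEN38.md`, `HOME/tower/gen36/NOTE-B6-UNIVERSAL-NORMS-GEN36.md`). Notation:
`K` a number field (mostly `K = ℚ`), `κ` a `ℤ_p`-extension, `Γ_∞ = ker κ`, `B = E(K_∞)[p^∞] = E[p^∞]^{Γ_∞}`.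

* §1 `mem_fixedPoints_kerSubgroup_iff`, `exists_forall_sub_mem_fixedPoints_of_resOfLe_eq_zero` — a class of `H¹(H, E[p^∞])`
  (`Γ_∞ ≤ H`) that DIES over `K_∞` is represented, up to a coboundary, by a `B`-VALUED cocycle: if `φ|_{Γ_∞} = ∂Q` then
  `φ(σ) − (σQ − Q) ∈ B` for all `σ ∈ H` (cocycle identity + normality of `Γ_∞`);
* §2 `exists_pow_nsmul_eq_zero_of_mem_fixedPoints` (`K = ℚ`: a uniform `p^e` kills the finite group `B`),
  `exists_pow_nsmul_eq_zero_of_resOfLe_kerSubgroup_eq_zero` (hence `p^e` kills `ker (H¹(H, E[p^∞]) → H¹(Γ_∞, E[p^∞]))` for every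
  `H ≥ Γ_∞`, uniformly in `H`);
* §3 `exists_forall_sum_smul_eq_zero_of_fixed` (`K = ℚ`): for `m ≫ 0`, EVERY system `s` of representatives of `Γ_ℚ ⧸ Γ_m` and every
  `t ∈ E[p^∞]` fixed by `Γ_m`, the norm `Σ_x s(x)·t` vanishes (the arbitrary-transversal form of p724678
  `TorsionEulerChar.exists_forall_sum_pow_smul_eq_zero`);
* §4 `exists_coresLe_oneCocycleClass_eq_of_forall_eq_sub` (generic `G`, `H ≤ H′`, `ι : X ⟶ Z`): the relative corestriction of a
  class PRINCIPAL in a bigger module, `ι ∘ g = ∂Q`, is principal there: `cor_{H′/H}[g] = [g′]` with `ι ∘ g′ = ∂(Σ_x s(x)·Q)`.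
[cite: GreenbergLNM1716, §3 Lemma 3.1 (p. 86), §4 Lemma 4.6 (pp. 105–108)] [cite: NeukirchSchmidtWingberg2008, I §5 (1.5.2)–(1.5.7)]
[cite: SerreGaloisCohomology1997, I §2.4, I §5.1]
-/

noncomputable section

open scoped Classical NumberField

namespace Summit.BirchSwinnertonDyer.BirchSwinnertonDyer.Theorems

namespace TorsionEulerChar.B6

open CategoryTheory Field NumberField IsDedekindDomain WeierstrassCurve
  Literature.NumberTheory.EllipticCurves Literature.NumberTheory.GaloisRepresentations
open _root_.TopRep _root_.ContinuousCohomology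

universe u v

/-! ## §1 Classes that die over `K_∞` are `B`-valued -/

section BValued

variable {K : Type} [Field K] (W : WeierstrassCurve K) (p : ℕ) [hp : Fact p.Prime] (κ : ZpExtension K p)

/-- Membership in `B = E[p^∞]^{Γ_∞}` (`FixedPoints.addSubgroup Γ_∞ E[p^∞]`): fixed by every `τ ∈ Γ_∞ = ker κ`. [folklore] -/
theorem mem_fixedPoints_kerSubgroup_iff (P : W.geomPrimaryTorsion p) :
    P ∈ FixedPoints.addSubgroup κ.kerSubgroup (W.geomPrimaryTorsion p) ↔
      ∀ τ : absoluteGaloisGroup K, τ ∈ κ.kerSubgroup → τ • P = P := by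
  rw [FixedPoints.mem_addSubgroup]
  constructor
  · intro h τ hτ
    exact h ⟨τ, hτ⟩
  · intro h τ
    rw [Subgroup.mk_smul]
    exact h τ τ.2

/-- **A class of `H¹(H, E[p^∞])` dying over `K_∞` is `B`-valued up to a coboundary.** Let `Γ_∞ = ker κ ≤ H ≤ Γ_K` and `φ` a
continuous `1`-cocycle of `H` with values in `E[p^∞]` whose class restricts to `0` on `Γ_∞`. Then there is `Q ∈ E[p^∞]` with
`φ(σ) − (σQ − Q) ∈ B = E[p^∞]^{Γ_∞}` for every `σ ∈ H`. Proof: `φ|_{Γ_∞} = ∂Q`; the cocycle `φ′ = φ − ∂Q` vanishes on the NORMAL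
subgroup `Γ_∞`, so `φ′(τσ) = τφ′(σ)` and `φ′(τσ) = φ′(σ·σ⁻¹τσ) = φ′(σ)`. [cite: SerreGaloisCohomology1997, I §5.1, I §2.6 (b)]
[cite: GreenbergLNM1716, §3 Lemma 3.1 (p. 86)] -/
theorem exists_forall_sub_mem_fixedPoints_of_resOfLe_eq_zero {H : Subgroup (absoluteGaloisGroup K)}
    (hH : κ.kerSubgroup ≤ H) (φ : contOneCocycles (discreteTopRep H (W.geomPrimaryTorsion p)))
    (hφ : W.resOfLe p hH (oneCocycleClass _ φ) = 0) :
    ∃ Q : W.geomPrimaryTorsion p, ∀ σ : H,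
      φ.1 σ - ((σ : absoluteGaloisGroup K) • Q - Q) ∈ FixedPoints.addSubgroup κ.kerSubgroup (W.geomPrimaryTorsion p) := by
  change resH1Hom (subgroupInclusion hH) (AddMonoidHom.id _) (fun _ _ ↦ rfl) (oneCocycleClass _ φ) = 0 at hφ
  rw [resH1Hom_oneCocycleClass, oneCocycleClass_eq_zero_iff] at hφ
  obtain ⟨Q, hQ⟩ := hφ
  have hQ' : ∀ (τ : absoluteGaloisGroup K) (hτ : τ ∈ κ.kerSubgroup), φ.1 ⟨τ, hH hτ⟩ = τ • Q - Q := fun τ hτ ↦ hQ ⟨τ, hτ⟩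
  refine ⟨Q, fun σ ↦ (mem_fixedPoints_kerSubgroup_iff W p κ _).2 fun τ hτ ↦ ?_⟩
  -- `c = σ⁻¹ τ σ ∈ Γ_∞`
  have hc : (σ : absoluteGaloisGroup K)⁻¹ * τ * σ ∈ κ.kerSubgroup := by
    have h := Subgroup.Normal.conj_mem inferInstance τ hτ (σ : absoluteGaloisGroup K)⁻¹
    rwa [inv_inv] at h
  have hcH : (σ : absoluteGaloisGroup K)⁻¹ * τ * σ ∈ H := hH hc
  -- cocycle identities: `φ(τ'σ) = φ τ' + τ φ σ` and `φ(σ c) = φ σ + σ φ c`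
  have h1 := φ.2 ⟨τ, hH hτ⟩ σ
  have h2 := φ.2 σ ⟨_, hcH⟩
  have heq : (⟨τ, hH hτ⟩ : H) * σ = σ * ⟨_, hcH⟩ := Subtype.ext (by
    simp only [Subgroup.coe_mul]; group)
  rw [heq, h2] at h1
  rw [hQ' τ hτ, hQ' _ hc] at h1
  -- `h1 : φ σ + σ • (c • Q - Q) = (τ • Q - Q) + τ • φ σ`
  have h1' : φ.1 σ + (σ : absoluteGaloisGroup K) • ((((σ : absoluteGaloisGroup K)⁻¹ * τ * σ) • Q) - Q) =
      (τ • Q - Q) + τ • φ.1 σ := h1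
  have hσc : (σ : absoluteGaloisGroup K) • (((σ : absoluteGaloisGroup K)⁻¹ * τ * σ) • Q) = τ • ((σ : absoluteGaloisGroup K) • Q) := by
    rw [smul_smul, ← mul_assoc, ← mul_assoc, mul_inv_cancel, one_mul, ← smul_smul]
  rw [smul_sub, hσc] at h1'
  rw [smul_sub, smul_sub]
  -- linear combination
  have h3 : τ • φ.1 σ = φ.1 σ + (τ • ((σ : absoluteGaloisGroup K) • Q) - (σ : absoluteGaloisGroup K) • Q) - (τ • Q - Q) := by
    rw [← sub_eq_iff_eq_add'.2 h1'.symm]; abel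
  rw [h3]; abel

end BValued

/-! ## §2 A uniform power of `p` kills `B` (over `ℚ`) and hence every class dying over `ℚ_∞` -/

section Exponent

variable (W : WeierstrassCurve ℚ) [W.IsElliptic] (p : ℕ) [hp : Fact p.Prime] (κ : ZpExtension ℚ p)

/-- **`p^e · B = 0`** for a uniform `e`: `B = E(ℚ_∞)[p^∞]` is finite (`finite_fixedPoints_kerSubgroup_geomPrimaryTorsion_rat`) and
`p`-primary. [cite: GreenbergLNM1716, §1 p. 62 (`E(F_∞)_tors` finite), §3 Lemma 3.1 (p. 86)] -/
theorem exists_pow_nsmul_eq_zero_of_mem_fixedPoints :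
    ∃ e : ℕ, ∀ P : W.geomPrimaryTorsion p, P ∈ FixedPoints.addSubgroup κ.kerSubgroup (W.geomPrimaryTorsion p) → p ^ e • P = 0 := by
  haveI := W.finite_fixedPoints_kerSubgroup_geomPrimaryTorsion_rat κ
  obtain ⟨e, he⟩ := exists_uniform_pow_smul_eq_zero p
    ((FixedPoints.addSubgroup κ.kerSubgroup (W.geomPrimaryTorsion p) : Set (W.geomPrimaryTorsion p))) (Set.toFinite _)
    fun s _ ↦ by
      obtain ⟨k, hk⟩ := (AddCommGroup.mem_primaryComponent).mp s.2
      exact ⟨k, Subtype.ext (by rw [AddSubgroupClass.coe_nsmul, hk, ZeroMemClass.coe_zero])⟩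
  exact ⟨e, fun P hP ↦ he P hP⟩

/-- **`p^e` kills every class of `H¹(H, E[p^∞])` (`Γ_∞ ≤ H`) that dies over `ℚ_∞`**, with ONE `e` for all `H`: by §1 such a class is
represented by `σ ↦ b(σ) + (σQ − Q)` with `b` `B`-valued, and `p^e b = 0`, so `p^e` times the class is the coboundary `∂(p^e Q)`. In
particular `p^e` kills `ker (H¹(ℚ_n, E[p^∞]) → H¹(ℚ_∞, E[p^∞]))` for every `n` (Greenberg's Lemma 3.1 with a uniform exponent).
[cite: GreenbergLNM1716, §3 Lemma 3.1 (p. 86)] -/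
theorem exists_pow_nsmul_eq_zero_of_resOfLe_kerSubgroup_eq_zero :
    ∃ e : ℕ, ∀ {H : Subgroup (absoluteGaloisGroup ℚ)} (hH : κ.kerSubgroup ≤ H) (y : W.subgroupH1 p H),
      W.resOfLe p hH y = 0 → p ^ e • y = 0 := by
  obtain ⟨e, he⟩ := exists_pow_nsmul_eq_zero_of_mem_fixedPoints W p κ
  refine ⟨e, fun {H} hH y hy ↦ ?_⟩
  obtain ⟨φ, hφy⟩ := oneCocycleClass_surjective (X := discreteTopRep H (W.geomPrimaryTorsion p)) y
  subst hφy
  obtain ⟨Q, hQ⟩ := exists_forall_sub_mem_fixedPoints_of_resOfLe_eq_zero W p κ hH φ hy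
  rw [← Nat.cast_smul_eq_nsmul ℤ, ← oneCocycleClass_smul, oneCocycleClass_eq_zero_iff]
  refine ⟨p ^ e • Q, fun σ ↦ ?_⟩
  have h0 := he _ (hQ σ)
  rw [nsmul_sub, sub_eq_zero] at h0
  change ((p ^ e : ℕ) : ℤ) • φ.1 σ = (σ : absoluteGaloisGroup ℚ) • (p ^ e • Q) - p ^ e • Q
  rw [natCast_zsmul, h0, smul_comm, nsmul_sub]

end Exponent

/-! ## §3 Norms of `Γ_m`-fixed `p`-power torsion points over an ARBITRARY transversal vanish for `m ≫ 0` -/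

section Norms

variable (W : WeierstrassCurve ℚ) [W.IsElliptic] (p : ℕ) [hp : Fact p.Prime] (κ : ZpExtension ℚ p)

/-- **`Σ_{x ∈ Γ_ℚ/Γ_m} s(x)·t = 0` for `m ≫ 0`, every transversal `s` and every `t ∈ E[p^∞]` fixed by `Γ_m`.** With `n₁` such that
`Γ_{n₁}` fixes `B = E(ℚ_∞)[p^∞]` pointwise (`B` finite) and `p^e B = 0`, take `m ≥ n₁ + e`: the summand `s(x)·t` only depends on the
image of `x` in `Γ/Γ_{n₁}` (`Γ_{n₁}` fixes `t ∈ B`), every fibre of `Γ/Γ_m → Γ/Γ_{n₁}` has `[Γ_{n₁} : Γ_m] = p^{m-n₁}` elements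
(`Subgroup.quotientEquivProdOfLE'`), and `p^{m-n₁} t = 0`. This is the arbitrary-transversal form of the torsion-norm lemma
`TorsionEulerChar.exists_forall_sum_pow_smul_eq_zero` (p724678), the shape consumed by the corestriction formula
`cores_eq_zero_of_forall_eq_sub_of_sum_eq`. [cite: GreenbergLNM1716, §1 p. 62, §4 Lemma 4.6 (p. 105)]
[cite: NeukirchSchmidtWingberg2008, I §5 (1.5.2)] -/
theorem exists_forall_sum_smul_eq_zero_of_fixed :
    ∃ m₁ : ℕ, ∀ m : ℕ, m₁ ≤ m → ∀ [Fintype (absoluteGaloisGroup ℚ ⧸ κ.layerSubgroup m)]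
      {s : absoluteGaloisGroup ℚ ⧸ κ.layerSubgroup m → absoluteGaloisGroup ℚ}
      (_hs : ∀ x, (s x : absoluteGaloisGroup ℚ ⧸ κ.layerSubgroup m) = x)
      (t : W.geomPrimaryTorsion p), (∀ σ ∈ κ.layerSubgroup m, σ • t = t) →
      ∑ x, s x • t = 0 := by
  have hprime : p.Prime := hp.out
  -- `B = E(ℚ_∞)[p^∞]` is finite; its pointwise stabiliser is open of finite index above `ker κ`
  haveI hB : Finite (FixedPoints.addSubgroup κ.kerSubgroup (geomPrimaryTorsion W p)) :=
    W.finite_fixedPoints_kerSubgroup_geomPrimaryTorsion_rat κ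
  set B : AddSubgroup (geomPrimaryTorsion W p) := FixedPoints.addSubgroup κ.kerSubgroup (geomPrimaryTorsion W p) with hBdef
  let S : Subgroup (absoluteGaloisGroup ℚ) := ⨅ b : B, MulAction.stabilizer (absoluteGaloisGroup ℚ) (b : geomPrimaryTorsion W p)
  have hSmem : ∀ σ : absoluteGaloisGroup ℚ, σ ∈ S ↔ ∀ b : B, σ • (b : geomPrimaryTorsion W p) = b := fun σ ↦ by
    simp only [S, Subgroup.mem_iInf, MulAction.mem_stabilizer_iff]
  have hSopen : IsOpen (S : Set (absoluteGaloisGroup ℚ)) := by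
    have hS : (S : Set (absoluteGaloisGroup ℚ)) =
        ⋂ b : B, (fun σ : absoluteGaloisGroup ℚ ↦ σ • (b : geomPrimaryTorsion W p)) ⁻¹' {(b : geomPrimaryTorsion W p)} := by
      ext σ
      simp only [SetLike.mem_coe, hSmem, Set.mem_iInter, Set.mem_preimage, Set.mem_singleton_iff]
    rw [hS]
    exact isOpen_iInter_of_finite fun b ↦
      (isOpen_discrete _).preimage (continuous_smul_geomPrimaryTorsion W p (b : geomPrimaryTorsion W p))
  haveI : CompactSpace (absoluteGaloisGroup ℚ) := absoluteGaloisGroup_compactSpace ℚ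
  haveI : Finite (absoluteGaloisGroup ℚ ⧸ S) := Subgroup.quotient_finite_of_isOpen _ hSopen
  haveI : S.FiniteIndex := Subgroup.finiteIndex_of_finite_quotient
  have hker : κ.kerSubgroup ≤ S := fun τ hτ ↦ (hSmem τ).mpr fun b ↦ (mem_fixedPoints_kerSubgroup_iff W p κ _).mp b.2 τ hτ
  obtain ⟨n₁, hn₁⟩ := ZpExtension.exists_layerSubgroup_le (κ := κ) hker Subgroup.FiniteIndex.index_ne_zero
  obtain ⟨e, he⟩ := exists_pow_nsmul_eq_zero_of_mem_fixedPoints W p κ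
  refine ⟨n₁ + e, fun m hm _ s hs t ht ↦ ?_⟩
  -- `t ∈ B`, fixed by `U = Γ_{n₁}`
  have htB : t ∈ B := (mem_fixedPoints_kerSubgroup_iff W p κ t).mpr fun τ hτ ↦ ht τ (κ.kerSubgroup_le_layerSubgroup m hτ)
  set U : Subgroup (absoluteGaloisGroup ℚ) := κ.layerSubgroup n₁ with hU
  have hfixU : ∀ σ ∈ U, σ • t = t := fun σ hσ ↦ (hSmem σ).mp (hn₁ hσ) ⟨t, htB⟩
  have hle : κ.layerSubgroup m ≤ U := κ.layerSubgroup_antitone (by omega)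
  -- the index `[U : Γ_m] = p^{m-n₁}`
  have hrel : (κ.layerSubgroup m).relIndex U * p ^ n₁ = p ^ m := by
    rw [← κ.index_layerSubgroup n₁, ← κ.index_layerSubgroup m]; exact Subgroup.relIndex_mul_index hle
  have hrel' : (κ.layerSubgroup m).relIndex U = p ^ (m - n₁) := by
    have h : (κ.layerSubgroup m).relIndex U = p ^ m / p ^ n₁ :=
      (Nat.div_eq_of_eq_mul_left (pow_pos hprime.pos n₁) hrel.symm).symm
    rw [h, Nat.pow_div (by omega) hprime.pos]
  haveI : ((κ.layerSubgroup m).subgroupOf U).FiniteIndex := ⟨by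
    change (κ.layerSubgroup m).relIndex U ≠ 0
    rw [hrel']; exact pow_ne_zero _ hprime.ne_zero⟩
  haveI : Finite (absoluteGaloisGroup ℚ ⧸ U) := Subgroup.quotient_finite_of_isOpen _ (κ.isOpen_layerSubgroup n₁)
  haveI : Fintype (absoluteGaloisGroup ℚ ⧸ U) := Fintype.ofFinite _
  haveI : Fintype (U ⧸ (κ.layerSubgroup m).subgroupOf U) := Fintype.ofFinite _
  -- the equivalence `Γ/Γ_m ≃ Γ/U × U/Γ_m`
  set f : absoluteGaloisGroup ℚ ⧸ U → absoluteGaloisGroup ℚ := Quotient.out with hf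
  have hff : Function.RightInverse f QuotientGroup.mk := Quotient.out_eq
  set E := Subgroup.quotientEquivProdOfLE' hle f hff with hE
  -- the summand depends only on the image in `Γ/U`
  have hval : ∀ x : absoluteGaloisGroup ℚ ⧸ κ.layerSubgroup m, s x • t = f (E x).1 • t := by
    intro x
    induction x using QuotientGroup.induction_on with
    | H g =>
      have h1 : (E (g : absoluteGaloisGroup ℚ ⧸ κ.layerSubgroup m)).1 = (g : absoluteGaloisGroup ℚ ⧸ U) := rfl
      rw [h1]
      have h2 : (f (g : absoluteGaloisGroup ℚ ⧸ U))⁻¹ * g ∈ U := QuotientGroup.eq.1 (hff (g : absoluteGaloisGroup ℚ ⧸ U))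
      have h3 : (s (g : absoluteGaloisGroup ℚ ⧸ κ.layerSubgroup m))⁻¹ * g ∈ κ.layerSubgroup m := QuotientGroup.eq.1 (hs g)
      have h4 : (f (g : absoluteGaloisGroup ℚ ⧸ U))⁻¹ * s (g : absoluteGaloisGroup ℚ ⧸ κ.layerSubgroup m) ∈ U := by
        have h5 : (f (g : absoluteGaloisGroup ℚ ⧸ U))⁻¹ * s (g : absoluteGaloisGroup ℚ ⧸ κ.layerSubgroup m) =
            ((f (g : absoluteGaloisGroup ℚ ⧸ U))⁻¹ * g) * ((s (g : absoluteGaloisGroup ℚ ⧸ κ.layerSubgroup m))⁻¹ * g)⁻¹ := by group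
        rw [h5]
        exact U.mul_mem h2 (U.inv_mem (hle h3))
      have h6 : s (g : absoluteGaloisGroup ℚ ⧸ κ.layerSubgroup m) =
          f (g : absoluteGaloisGroup ℚ ⧸ U) * ((f (g : absoluteGaloisGroup ℚ ⧸ U))⁻¹ * s (g : absoluteGaloisGroup ℚ ⧸ κ.layerSubgroup m)) := by
        group
      rw [h6, mul_smul, hfixU _ h4]
  -- kill: `p^{m-n₁} t = 0`
  have hkill : p ^ (m - n₁) • t = 0 := by
    obtain ⟨d, hd⟩ := Nat.exists_eq_add_of_le (show e ≤ m - n₁ by omega)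
    rw [hd, pow_add, mul_comm, mul_nsmul', he t htB, nsmul_zero]
  calc ∑ x, s x • t = ∑ x, f (E x).1 • t := Finset.sum_congr rfl fun x _ ↦ hval x
    _ = ∑ yz : (absoluteGaloisGroup ℚ ⧸ U) × (U ⧸ (κ.layerSubgroup m).subgroupOf U), f yz.1 • t :=
        Fintype.sum_equiv E _ _ fun x ↦ rfl
    _ = ∑ y : absoluteGaloisGroup ℚ ⧸ U, ∑ _z : U ⧸ (κ.layerSubgroup m).subgroupOf U, f y • t := Fintype.sum_prod_type _
    _ = ∑ y : absoluteGaloisGroup ℚ ⧸ U, p ^ (m - n₁) • (f y • t) := by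
        refine Finset.sum_congr rfl fun y _ ↦ ?_
        rw [Finset.sum_const, Finset.card_univ, ← Nat.card_eq_fintype_card, ← Subgroup.index_eq_card]
        exact congrArg (· • (f y • t)) hrel'
    _ = 0 := Finset.sum_eq_zero fun y _ ↦ by rw [smul_comm, hkill, smul_zero]

end Norms

/-! ## §4 The relative corestriction of a class principal in a bigger module is principal there -/

section Principal

variable {R : Type u} [CommRing R] [TopologicalSpace R]
variable {G : Type v} [Group G] [TopologicalSpace G] [IsTopologicalGroup G]
variable {X Z : TopRep.{v} R G} {H H' : Subgroup G}

/-- **`cor_{H′/H}` of a class principal in a bigger module is principal there.** Let `ι : X ⟶ Z` be a morphism of topological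
representations of `G`, `H ≤ H′` with `H` open of finite index in `H′`, `s` a transversal of `H′/H`, and `g` a continuous `1`-cocycle of
`H` with values in `X` such that `ι(g(n)) = n·Q − Q` for some `Q ∈ Z`. Then `cor_{H′/H} [g] = [g′]` for a cocycle `g′` of `H′` with
`ι(g′(a)) = a·Q′ − Q′`, `Q′ = Σ_{x ∈ H′/H} s(x)·Q` (the transfer of `∂Q`, read in `Z`, is `∂Q′`). Companion of
`cores_eq_zero_of_forall_eq_sub_of_sum_eq` (the case `Q′ ∈ ι(X)`). [cite: NeukirchSchmidtWingberg2008, I §5 (1.5.2)] -/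
theorem exists_coresLe_oneCocycleClass_eq_of_forall_eq_sub (h : H ≤ H') (hH : IsOpen (H : Set G))
    [Fintype (H' ⧸ H.subgroupOf H')] {s : H' ⧸ H.subgroupOf H' → H'} (hs : ∀ x, (s x : H' ⧸ H.subgroupOf H') = x)
    (ι : X ⟶ Z) (g : contOneCocycles (subgroupRep X H)) (Q : Z) (hg : ∀ n : H, ι.hom (g.1 n) = Z.ρ (n : G) Q - Q) :
    ∃ g' : contOneCocycles (subgroupRep X H'),
      coresLe X h hH (oneCocycleClass _ g) = oneCocycleClass _ g' ∧
        ∀ a : H', ι.hom (g'.1 a) =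
          Z.ρ (a : G) (∑ x : H' ⧸ H.subgroupOf H', Z.ρ (s x : G) Q) - ∑ x : H' ⧸ H.subgroupOf H', Z.ρ (s x : G) Q := by
  -- the transfer cocycle
  let gH : contOneCocycles (subgroupRep (subgroupRep X H') (H.subgroupOf H')) :=
    contOneCocycles.pullback (subgroupOfHom h) (Y := subgroupRep (subgroupRep X H') (H.subgroupOf H'))
      (TopRep.ofHom ⟨ContinuousLinearMap.id R X, fun _ => rfl⟩) g
  refine ⟨transferCocycle (subgroupRep X H') (H.subgroupOf H') (isOpen_subgroupOf H' hH) hs gH,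
    coresLe_oneCocycleClass X h hH hs g, fun a ↦ ?_⟩
  -- the same cocycle read in `Z`
  let gZ : contOneCocycles (subgroupRep (subgroupRep Z H') (H.subgroupOf H')) :=
    contOneCocycles.pullback (ContinuousMonoidHom.id _) (resIdHom (subgroupRepHom (subgroupRepHom ι H') (H.subgroupOf H'))) gH
  have hgg : ∀ n : H.subgroupOf H', gZ.1 n = ι.hom (gH.1 n) := fun n ↦ by
    rw [pullback_id_resIdHom_apply, subgroupRepHom_hom_apply, subgroupRepHom_hom_apply]
  have hgH : ∀ n : H.subgroupOf H', gH.1 n = g.1 (subgroupOfHom h n) := fun _ ↦ rfl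
  have hgZ : ∀ n : H.subgroupOf H', gZ.1 n = (subgroupRep Z H').ρ (n : H') Q - Q := fun n ↦ by
    rw [hgg, hgH, hg, subgroupRep_ρ_apply]
    rfl
  have h1 : ι.hom (transferFun (subgroupRep X H') (H.subgroupOf H') hs gH a) = transferFun (subgroupRep Z H') (H.subgroupOf H') hs gZ a :=
    (transferFun_congr_of_hom (subgroupRep Z H') (H.subgroupOf H') hs (subgroupRep X H') ι.hom.toLinearMap.toAddMonoidHom
      (fun b y ↦ TopRep.hom_comm_apply ι b y) gH gZ hgg a).symm
  rw [transferCocycle_apply, h1, transferFun_eq_of_forall_eq_sub (subgroupRep Z H') (H.subgroupOf H') hs gZ Q hgZ a]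
  rfl

end Principal

/-! ## §5 Over `ℚ`: the corestriction to `Γ_ℚ` of a principal class of a deep layer vanishes -/

section PrincipalDies

variable (W : WeierstrassCurve ℚ) [W.IsElliptic] (p : ℕ) [hp : Fact p.Prime] (κ : ZpExtension ℚ p)

/-- **`cor_{Γ_m → Γ_ℚ}` kills the principal classes of `H¹(Γ_m, E[M])` for `m ≫ 0`.** If a cocycle `g` of `Γ_m = Gal(ℚ̄/ℚ_m)` with
values in `E[M]` is `∂Q` for a `p`-power torsion point `Q ∈ E(ℚ̄)` (so `t = M·Q ∈ E(ℚ_m)[p^∞]`), then `cor [g] = ∂(Σ_x s(x)·Q) = 0` in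
`H¹(Γ_ℚ, E[M])`, because `M · Σ_x s(x)·Q = N_{ℚ_m/ℚ} t = 0` (§3) puts the norm of `Q` inside `E[M]`. These are the classes
`δ_M(t)`, `t ∈ E(ℚ_m)[p^∞]`, of the compact-Selmer bookkeeping. [cite: GreenbergLNM1716, §4 Lemma 4.6 (pp. 105–108)]
[cite: NeukirchSchmidtWingberg2008, I §5 (1.5.2)] -/
theorem exists_forall_cores_eq_zero_of_forall_eq_sub :
    ∃ m₁ : ℕ, ∀ m : ℕ, m₁ ≤ m → ∀ [Fintype (absoluteGaloisGroup ℚ ⧸ κ.layerSubgroup m)] (M : ℕ)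
      (ι : (W.torsionGaloisModule (M : ℤ)).toTopRep ⟶ discreteTopRep (absoluteGaloisGroup ℚ) (W.geomPrimaryTorsion p))
      (_hι : ∀ P : W.geomTorsion (M : ℤ), ((ι.hom P : W.geomPrimaryTorsion p) : W.geomPoints) = (P : W.geomPoints))
      (g : contOneCocycles (subgroupRep (W.torsionGaloisModule (M : ℤ)).toTopRep (κ.layerSubgroup m)))
      (Q : W.geomPrimaryTorsion p),
      (∀ n : κ.layerSubgroup m, ι.hom (g.1 n) = (n : absoluteGaloisGroup ℚ) • Q - Q) →
      cores (W.torsionGaloisModule (M : ℤ)).toTopRep (κ.layerSubgroup m) (κ.isOpen_layerSubgroup m) (oneCocycleClass _ g) = 0 := by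
  obtain ⟨m₁, hm₁⟩ := exists_forall_sum_smul_eq_zero_of_fixed W p κ
  refine ⟨m₁, fun m hm _ M ι hι g Q hg ↦ ?_⟩
  have hιinj : Function.Injective ι.hom := fun P P' h ↦ Subtype.ext (by rw [← hι P, ← hι P', h])
  -- `t = M • Q` is fixed by `Γ_m`
  have hsmulM : ∀ n : κ.layerSubgroup m, M • ((n : absoluteGaloisGroup ℚ) • Q - Q) = 0 := fun n ↦ by
    rw [← hg n]
    apply Subtype.ext
    rw [AddSubgroupClass.coe_nsmul, hι, ZeroMemClass.coe_zero, ← natCast_zsmul]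
    exact (mem_geomTorsion_iff W _ _).mp (g.1 n).2
  have hfix : ∀ σ ∈ κ.layerSubgroup m, σ • (M • Q) = M • Q := fun σ hσ ↦ by
    have h := hsmulM ⟨σ, hσ⟩
    rw [nsmul_sub, sub_eq_zero] at h
    rw [smul_comm, h]
  -- the norm of `Q` lies in `E[M]`
  have hnorm : ∑ x : absoluteGaloisGroup ℚ ⧸ κ.layerSubgroup m, Quotient.out x • (M • Q) = 0 :=
    hm₁ m hm QuotientGroup.out_eq' (M • Q) hfix
  have hmem : ((∑ x : absoluteGaloisGroup ℚ ⧸ κ.layerSubgroup m, Quotient.out x • Q : W.geomPrimaryTorsion p) : W.geomPoints) ∈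
      W.geomTorsion (M : ℤ) := by
    rw [mem_geomTorsion_iff, natCast_zsmul, ← AddSubgroupClass.coe_nsmul, Finset.smul_sum]
    simp_rw [smul_comm (M : ℕ)]
    rw [hnorm, ZeroMemClass.coe_zero]
  refine cores_eq_zero_of_forall_eq_sub_of_sum_eq (κ.layerSubgroup m) (κ.isOpen_layerSubgroup m) QuotientGroup.out_eq' ι hιinj g Q
    hg ⟨_, hmem⟩ (Subtype.ext ?_)
  rw [hι]
  rfl

end PrincipalDies

end TorsionEulerChar.B6

end Summit.BirchSwinnertonDyer.BirchSwinnertonDyer.Theorems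

end
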